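import Mathlib
import Summits.PneNP.PneNP.Theorems.Nc03AvoidResidualCoreReductionNPN

/-!
# Route Nc03AvoidResidualCore, item `ResidualCoreReduction` — the classes with forcing literals

Helper file for `stmt-PneNP-20227` (residual-core reduction of `NC⁰₃-AVOID` at linear stretch; cell
pnp-ideate, dossier HOME/pnp-ideate-p2/ROUND-3.md §2.3). For a PURE instance (`IsPure (rep c)`, one
predicate, three distinct positions per output) of each NPN class `c` whose representative has a
FORCING literal we give

* a certificate SOUNDNESS theorem: an explicit pattern on `O(1)` outputs that is never attained, and
* an EXISTENCE theorem: above a linear number of outputs such a pattern exists,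

namely for `c = 0` (constant; one output), `c = 1` (dictator; two outputs on the same copy,
`M > N`), `c = 2` (`AND₂`; an output both of whose read variables are read elsewhere, `M > N`),
`c = 4` (`AND₃`; likewise with three variables, `M > N`) and `c = 5` (`a ∧ (b ∨ c)`; a head with a
`1`-output whose two tails are switched off by `0`-outputs of switched-on heads, `M > 3N`). The
existence proofs are private-variable injections (if no pattern exists, every output owns a variable
nobody else reads, so there are at most `N` outputs). All statements are about the finite
combinatorics of `LocalMap`; the polynomial-time search that finds the patterns is elsewhere.
[folklore; ROUND-3 §2.3]
-/

set_option linter.dupNamespace false -- `Summit.PneNP.PneNP.…`: summit = sub-problem name (D-0017 single-conjunct layout)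

namespace Summit.PneNP.PneNP.Theorems.Nc03Reduction

open Finset Literature.Computability.Complexity

variable {N M : ℕ}

/-- Evaluation of a pure instance: output `j` is the representative applied to the read bits. -/
theorem eval_of_isPure {P : (Fin 3 → Bool) → Bool} {I : LocalMap 3 N M} (hP : I.IsPure P)
    (x : Fin N → Bool) (j : Fin M) : I.eval x j = P (fun i => x (I.vars j i)) := by
  simp only [LocalMap.eval, hP.1 j]

/-- **Private-variable injection.** If every output in `S` reads (among the positions `rd`) some
variable read by no other output of `S`, then `|S| ≤ N`. [folklore] -/
theorem card_le_of_private (S : Finset (Fin M)) (rd : Fin M → Finset (Fin N))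
    (h : ∀ j ∈ S, ∃ v ∈ rd j, ∀ j' ∈ S, j' ≠ j → v ∉ rd j') : S.card ≤ N := by
  classical
  rcases S.eq_empty_or_nonempty with rfl | ⟨j₀, hj₀⟩
  · simp
  obtain ⟨v₀, -, -⟩ := h j₀ hj₀
  haveI : Nonempty (Fin N) := ⟨v₀⟩
  choose! φ hφ hpriv using h
  calc S.card = (S.image φ).card := by
        refine (Finset.card_image_of_injOn fun j hj j' hj' (e : φ j = φ j') => ?_).symm
        by_contra hne
        exact hpriv j hj j' hj' (fun h => hne h.symm) (e ▸ hφ j' hj')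
    _ ≤ (Finset.univ : Finset (Fin N)).card := Finset.card_le_card (Finset.subset_univ _)
    _ = N := by simp

/-! ## Class 0: constant outputs -/

/-- Soundness, class `0`: a constant-`false` output never shows `true`. -/
theorem cert0_sound {I : LocalMap 3 N M} (hP : I.IsPure (rep 0)) (j : Fin M) {y : Fin M → Bool}
    (hy : y j = true) : y ∉ I.range := by
  rintro ⟨x, rfl⟩
  rw [eval_of_isPure hP] at hy
  simp [rep] at hy

/-! ## Class 1: dictator outputs -/

/-- Soundness, class `1`: two outputs copying the same variable never disagree. -/
theorem cert1_sound {I : LocalMap 3 N M} (hP : I.IsPure (rep 1)) {j j' : Fin M}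
    (hv : I.vars j 0 = I.vars j' 0) {y : Fin M → Bool} (hy : y j ≠ y j') : y ∉ I.range := by
  rintro ⟨x, rfl⟩
  rw [eval_of_isPure hP, eval_of_isPure hP] at hy
  simp [rep, hv] at hy

/-- Existence, class `1`: with more outputs than variables two outputs copy the same variable. -/
theorem cert1_exists (I : LocalMap 3 N M) (hM : N < M) :
    ∃ j j' : Fin M, j ≠ j' ∧ I.vars j 0 = I.vars j' 0 := by
  have := Fintype.exists_ne_map_eq_of_card_lt (fun j : Fin M => I.vars j 0) (by simpa using hM)
  obtain ⟨j, j', hne, he⟩ := this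
  exact ⟨j, j', hne, he⟩

/-! ## Class 2: `AND₂` outputs -/

/-- The variables an output reads in roles `0, 1`. -/
def rd2 (I : LocalMap 3 N M) (j : Fin M) : Finset (Fin N) := {I.vars j 0, I.vars j 1}

/-- Soundness, class `2` (`a ∧ b`): if both variables of output `e` are read (in roles `0,1`) by
outputs `f, g ≠ e`, the pattern `y f = y g = 1, y e = 0` is never attained. -/
theorem cert2_sound {I : LocalMap 3 N M} (hP : I.IsPure (rep 2)) {e f g : Fin M}
    (hf : I.vars e 0 ∈ rd2 I f) (hg : I.vars e 1 ∈ rd2 I g) {y : Fin M → Bool}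
    (hyf : y f = true) (hyg : y g = true) (hye : y e = false) : y ∉ I.range := by
  rintro ⟨x, rfl⟩
  rw [eval_of_isPure hP] at hyf hyg hye
  simp only [rep, Bool.and_eq_true] at hyf hyg
  simp only [rep, Bool.and_eq_false_iff] at hye
  simp only [rd2, Finset.mem_insert, Finset.mem_singleton] at hf hg
  have h0 : x (I.vars e 0) = true := by rcases hf with h | h <;> rw [h] <;> simp [hyf]
  have h1 : x (I.vars e 1) = true := by rcases hg with h | h <;> rw [h] <;> simp [hyg]
  rcases hye with h | h
  · rw [h0] at h; exact Bool.noConfusion h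
  · rw [h1] at h; exact Bool.noConfusion h

/-- Existence, class `2`: with `M > N` outputs some output has both variables read elsewhere. -/
theorem cert2_exists (I : LocalMap 3 N M) (hM : N < M) :
    ∃ e f g : Fin M, f ≠ e ∧ g ≠ e ∧ I.vars e 0 ∈ rd2 I f ∧ I.vars e 1 ∈ rd2 I g := by
  by_contra hno
  push Not at hno
  have hle := card_le_of_private (Finset.univ : Finset (Fin M)) (rd2 I) (fun e _ => ?_)
  · simp at hle; omega
  · by_cases h0 : ∀ f : Fin M, f ≠ e → I.vars e 0 ∉ rd2 I f
    · exact ⟨I.vars e 0, by simp [rd2], fun f _ hf => h0 f hf⟩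
    · push Not at h0
      obtain ⟨f, hfe, hf⟩ := h0
      refine ⟨I.vars e 1, by simp [rd2], fun g _ hge hg => ?_⟩
      exact hno e f g hfe hge hf hg

/-! ## Class 4: `AND₃` outputs -/

/-- The variables an output reads (all three roles). -/
def rd3 (I : LocalMap 3 N M) (j : Fin M) : Finset (Fin N) := {I.vars j 0, I.vars j 1, I.vars j 2}

/-- Soundness, class `4` (`a ∧ b ∧ c`): if each variable of `e` is read by an output `f_r ≠ e`, the
pattern `y f₀ = y f₁ = y f₂ = 1, y e = 0` is never attained. -/
theorem cert4_sound {I : LocalMap 3 N M} (hP : I.IsPure (rep 4)) {e : Fin M} {f : Fin 3 → Fin M}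
    (hf : ∀ r, I.vars e r ∈ rd3 I (f r)) {y : Fin M → Bool}
    (hyf : ∀ r, y (f r) = true) (hye : y e = false) : y ∉ I.range := by
  rintro ⟨x, rfl⟩
  have hall : ∀ r, x (I.vars e r) = true := by
    intro r
    have h := hyf r
    rw [eval_of_isPure hP] at h
    simp only [rep, Bool.and_eq_true] at h
    have hm := hf r
    simp only [rd3, Finset.mem_insert, Finset.mem_singleton] at hm
    rcases hm with hm | hm | hm <;> rw [hm] <;> simp [h]
  rw [eval_of_isPure hP] at hye
  simp only [rep, hall, Bool.and_self] at hye
  exact Bool.noConfusion hye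

/-- Existence, class `4`: with `M > N` outputs some output has all three variables read elsewhere. -/
theorem cert4_exists (I : LocalMap 3 N M) (hM : N < M) :
    ∃ e : Fin M, ∃ f : Fin 3 → Fin M, ∀ r, f r ≠ e ∧ I.vars e r ∈ rd3 I (f r) := by
  by_contra hno
  push Not at hno
  have hle := card_le_of_private (Finset.univ : Finset (Fin M)) (rd3 I) (fun e _ => ?_)
  · simp at hle; omega
  · -- some role `r` of `e` is private; otherwise choose readers role by role
    by_contra hpriv
    push Not at hpriv
    have hch : ∀ r : Fin 3, ∃ f : Fin M, f ≠ e ∧ I.vars e r ∈ rd3 I f := by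
      intro r
      have hmem : I.vars e r ∈ rd3 I e := by
        fin_cases r <;> simp [rd3]
      obtain ⟨f, _, hfe, hf⟩ := hpriv (I.vars e r) hmem
      exact ⟨f, hfe, hf⟩
    choose f hf using hch
    obtain ⟨r, hr⟩ := hno e f
    exact hr (hf r).1 (hf r).2

/-! ## Class 5: `a ∧ (b ∨ c)` outputs -/

/-- The tail variables (roles `1, 2`) of an output. -/
def tails (I : LocalMap 3 N M) (j : Fin M) : Finset (Fin N) := {I.vars j 1, I.vars j 2}

/-- Soundness, class `5` (`a ∧ (b ∨ c)`, head = role `0`, tails = roles `1,2`). Pattern: `y j = 1`;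
tail `2` of `j` is a tail of the `0`-output `k` whose head is switched on by the `1`-output `k₁`;
tail `1` of `j` is a tail of the `0`-output `l` whose head is switched on by the `1`-output `l₁`.
Then `x_{head j} = 1` and both tails of `j` are forced to `0`: never attained. [ROUND-3 §2.3] -/
theorem cert5_sound {I : LocalMap 3 N M} (hP : I.IsPure (rep 5)) {j k k₁ l l₁ : Fin M}
    (hk : I.vars j 2 ∈ tails I k) (hk₁ : I.vars k₁ 0 = I.vars k 0)
    (hl : I.vars j 1 ∈ tails I l) (hl₁ : I.vars l₁ 0 = I.vars l 0) {y : Fin M → Bool}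
    (hyj : y j = true) (hyk₁ : y k₁ = true) (hyl₁ : y l₁ = true) (hyk : y k = false)
    (hyl : y l = false) : y ∉ I.range := by
  rintro ⟨x, rfl⟩
  simp only [eval_of_isPure hP, rep] at hyj hyk₁ hyl₁ hyk hyl
  simp only [Bool.and_eq_true, Bool.or_eq_true] at hyj hyk₁ hyl₁
  simp only [tails, Finset.mem_insert, Finset.mem_singleton] at hk hl
  -- head of `k` is on, so both tails of `k` are off
  have hk0 : x (I.vars k 0) = true := by rw [← hk₁]; exact hyk₁.1
  have hl0 : x (I.vars l 0) = true := by rw [← hl₁]; exact hyl₁.1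
  rw [hk0] at hyk; rw [hl0] at hyl
  simp only [Bool.true_and, Bool.or_eq_false_iff] at hyk hyl
  have h2 : x (I.vars j 2) = false := by rcases hk with h | h <;> rw [h] <;> simp [hyk]
  have h1 : x (I.vars j 1) = false := by rcases hl with h | h <;> rw [h] <;> simp [hyl]
  rcases hyj.2 with h | h
  · rw [h1] at h; exact Bool.noConfusion h
  · rw [h2] at h; exact Bool.noConfusion h

/-- The outputs with a given head. -/
def headClass (I : LocalMap 3 N M) (h : Fin N) : Finset (Fin M) :=
  Finset.univ.filter fun j => I.vars j 0 = h

/-- In a head class with at least three outputs one can pick an output avoiding two given ones. -/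
theorem exists_mem_headClass_notin {I : LocalMap 3 N M} {h : Fin N} (h3 : 3 ≤ (headClass I h).card)
    (k l : Fin M) : ∃ k₁, I.vars k₁ 0 = h ∧ k₁ ≠ k ∧ k₁ ≠ l := by
  have hlt : ({k, l} : Finset (Fin M)).card < (headClass I h).card :=
    lt_of_lt_of_le (lt_of_le_of_lt (Finset.card_le_two) (by norm_num)) h3
  obtain ⟨k₁, hk₁, hnot⟩ := Finset.exists_mem_notMem_of_card_lt_card hlt
  simp only [headClass, Finset.mem_filter, Finset.mem_univ, true_and] at hk₁
  simp only [Finset.mem_insert, Finset.mem_singleton, not_or] at hnot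
  exact ⟨k₁, hk₁, hnot.1, hnot.2⟩

/-- At most `2N` outputs have a head of degree `≤ 2`. -/
theorem card_smallHead_le (I : LocalMap 3 N M) :
    (Finset.univ.filter fun j : Fin M => (headClass I (I.vars j 0)).card ≤ 2).card ≤ 2 * N := by
  classical
  set T := Finset.univ.filter fun j : Fin M => (headClass I (I.vars j 0)).card ≤ 2
  have hsub : T ⊆ (Finset.univ.filter fun h : Fin N => (headClass I h).card ≤ 2).biUnion
      (headClass I) := by
    intro j hj
    simp only [T, Finset.mem_filter, Finset.mem_univ, true_and] at hj
    simp only [Finset.mem_biUnion, Finset.mem_filter, Finset.mem_univ, true_and]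
    exact ⟨I.vars j 0, hj, by simp [headClass]⟩
  calc T.card ≤ _ := Finset.card_le_card hsub
    _ ≤ ∑ h ∈ Finset.univ.filter (fun h : Fin N => (headClass I h).card ≤ 2),
          (headClass I h).card := Finset.card_biUnion_le
    _ ≤ ∑ _h ∈ Finset.univ.filter (fun h : Fin N => (headClass I h).card ≤ 2), 2 :=
          Finset.sum_le_sum fun h hh => (Finset.mem_filter.mp hh).2
    _ ≤ ∑ _h ∈ (Finset.univ : Finset (Fin N)), 2 :=
          Finset.sum_le_sum_of_subset_of_nonneg (Finset.filter_subset _ _) fun _ _ _ => by norm_num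
    _ = 2 * N := by simp [mul_comm]

/-- Existence, class `5`: with `M > 3N` outputs the pattern of `cert5_sound` exists (with the index
side conditions `k ≠ j`, `l ≠ j`, `k₁, l₁ ∉ {k, l}` that make the pattern a well-defined string).
Proof: discard the `≤ 2N` outputs whose head has degree `≤ 2`; among the remaining `> N` outputs one
has both tails read as tails by other remaining outputs (else each owns a private tail). -/
theorem cert5_exists (I : LocalMap 3 N M) (hM : 3 * N < M) :
    ∃ j k k₁ l l₁ : Fin M, k ≠ j ∧ l ≠ j ∧ k₁ ≠ k ∧ k₁ ≠ l ∧ l₁ ≠ k ∧ l₁ ≠ l ∧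
      I.vars j 2 ∈ tails I k ∧ I.vars k₁ 0 = I.vars k 0 ∧
      I.vars j 1 ∈ tails I l ∧ I.vars l₁ 0 = I.vars l 0 := by
  classical
  set R := Finset.univ.filter fun j : Fin M => 3 ≤ (headClass I (I.vars j 0)).card with hR
  have hRcard : N < R.card := by
    have hsplit := Finset.card_filter_add_card_filter_not
      (s := (Finset.univ : Finset (Fin M))) (fun j : Fin M => (headClass I (I.vars j 0)).card ≤ 2)
    have h2N := card_smallHead_le I
    have hR' : R = Finset.univ.filter fun j : Fin M => ¬ (headClass I (I.vars j 0)).card ≤ 2 := by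
      simp only [hR, not_le]
      rfl
    rw [← hR'] at hsplit
    simp only [Finset.card_univ, Fintype.card_fin] at hsplit
    omega
  -- either some `j ∈ R` has both tails covered inside `R`, or every `j ∈ R` owns a private tail
  by_cases hcov : ∃ j ∈ R, (∃ k ∈ R, k ≠ j ∧ I.vars j 2 ∈ tails I k) ∧
      (∃ l ∈ R, l ≠ j ∧ I.vars j 1 ∈ tails I l)
  · obtain ⟨j, -, ⟨k, hkR, hkj, hk⟩, ⟨l, hlR, hlj, hl⟩⟩ := hcov
    simp only [hR, Finset.mem_filter, Finset.mem_univ, true_and] at hkR hlR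
    obtain ⟨k₁, hk₁, hk₁k, hk₁l⟩ := exists_mem_headClass_notin hkR k l
    obtain ⟨l₁, hl₁, hl₁k, hl₁l⟩ := exists_mem_headClass_notin hlR k l
    exact ⟨j, k, k₁, l, l₁, hkj, hlj, hk₁k, hk₁l, hl₁k, hl₁l, hk, hk₁, hl, hl₁⟩
  · have hle := card_le_of_private R (tails I) fun j hj => ?_
    · omega
    · by_cases h2 : ∃ k ∈ R, k ≠ j ∧ I.vars j 2 ∈ tails I k
      · refine ⟨I.vars j 1, by simp [tails], fun l hl hlj hmem => ?_⟩
        exact hcov ⟨j, hj, h2, l, hl, hlj, hmem⟩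
      · push Not at h2
        exact ⟨I.vars j 2, by simp [tails], h2⟩

end Summit.PneNP.PneNP.Theorems.Nc03Reduction
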